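import Literature.NumberTheory.Sieve.FriedlanderIwaniecPrimesSmoothCutoff
import Literature.NumberTheory.Sieve.FriedlanderIwaniecPrimesLemma33
import Mathlib.Analysis.SpecialFunctions.Integrals.Basic
import HarnessLib

/-!
# Friedlander–Iwaniec, *The polynomial `X² + Y⁴` captures its primes*, Lemma 3.1: the oscillatory terms via Lemma 3.3

Family `parity`, statement parity.S17. Source: J. Friedlander, H. Iwaniec, Ann. of Math. (2) 148
(1998), 945–1040 [FriedlanderIwaniecAnnals1998], §3, proof of Lemma 3.1 (arXiv p. 13):
"To separate the modulus `d` from `k, b` in the Fourier integral we write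
`I(k, b; d) = √x k⁻¹ ∫ f(xt²k⁻² + b²) cos(2πt√x/d) dt` … Hence `|A_d(f) - M_d(f)|` is bounded by
`(4√x/d) ∫₀^K |∑_{0<b≤√x, t<k≤K} 𝔷(b) k⁻¹ f(xt²/k² + b²) ρ(k, b; d)| dt + …` Recall that `𝔷(b)` is
supported on squares … Applying Lemma 3.3 to the relevant triple sum and then integrating over
`0 < t < K` we obtain `∑_{d ≤ D} d |A_d(f) - M_d(f)| ≪ √x (D + C√(DK)) (CK)^{1/2+ε}`."

This file PROVES that step for the slices `b = c²`, `1 ≤ c ≤ C₀`, in the complex form of the tree's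
Fourier transform:

* `fiXi x y K C₀ s k ℓ = ξ_s(k, ℓ) = 𝔷⁺(ℓ) k⁻¹ f(xs²/k² + ℓ²)` (`𝔷⁺(ℓ) = #{1 ≤ c ≤ C₀ : c² = ℓ} ≤ 1`)
  and the linear form `fiXiForm x y K C₀ d s = Ξ_d(s) = ∑_{k ≤ K} ∑_{ℓ ≤ C₀²} ξ_s(k,ℓ) ρ(k,ℓ;d)`;
* `sum_sum_fiWeyl_mul_fourier_eq` (the change of variables, summed):
  `∑_{c ≤ C₀} ∑_{k ≤ K} ρ(k, c²; d) 𝓕F_c(k/d) = √x ∫ e(-s√x/d) Ξ_d(s) ds`;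
* `sum_norm_fiXi_sq_le`: `‖ξ_s‖² ≤ 2 C₀ / max(1, |s|)` and `Ξ_d(s) = 0` for `|s| ≥ K`;
* **`sum_norm_oscillatory_le`**: for every `ε > 0` (constant `c = c(ε)` of `fi_lemma33`),
  `∑_{d ≤ D} |∑_{c ≤ C₀} ∑_{k ≤ K} ρ(k,c²;d) 𝓕F_c(k/d)| ≤ √x · c (DKL)^ε (D + √(DKL)) · √(2C₀) · 4√K`,
  `L = C₀²` — FI's "`≪ √x (D + C√(DK)) (CK)^{1/2+ε}`" with `C₀ ≍ C = x^{1/4}`.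

## References

* J. Friedlander, H. Iwaniec, Ann. of Math. (2) 148 (1998), 945–1040, §3, (3.13).
  [cite: FriedlanderIwaniecAnnals1998, §3 (3.13)]

## Mathlib / tree search

Tree: `fiCutoff`, `fiCutoff_eq_zero`, `fiCutoff_mem_Icc`, `continuous_fiCutoff`, `fiProfileC`,
`fourier_fiProfileC_div` (`…SmoothCutoff`); `fiWeyl`, `norm_fiWeyl_le`, `card_fiRoots_le`
(`…WeylHarmonics`); `fi_lemma33` (`…Lemma33`); `LargeSieve.e`, `norm_e`. Mathlib: `integral_rpow`,
`intervalIntegral.integral_comp_neg`, `MeasureTheory.integral_finsetSum`,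
`MeasureTheory.norm_integral_le_integral_norm`, `sq_sum_le_card_mul_sum_sq`,
`sum_Ioc_inv_sq_le_sub`.
-/

noncomputable section

open Finset Real MeasureTheory Filter Complex Set
open scoped FourierTransform

namespace Literature.NumberTheory.Sieve.FriedlanderIwaniecPrimes

open LargeSieve

/-! ### The coefficients `ξ_s(k, ℓ)` and the linear forms `Ξ_d(s)` -/

/-- `ξ_s(k, ℓ) = ∑_{1 ≤ c ≤ C₀, c² = ℓ} k⁻¹ f(xs²/k² + c⁴)` — FI's `𝔷(b) k⁻¹ f(xt²/k² + b²)` for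
`b = ℓ = c²` (at most one `c`), as a complex number. [cite: FriedlanderIwaniecAnnals1998, §3, display before (3.13)] -/
def fiXi (x y : ℝ) (C₀ : ℕ) (s : ℝ) (k ℓ : ℕ) : ℂ :=
  ∑ c ∈ (Finset.Icc 1 C₀).filter (fun c => c ^ 2 = ℓ),
    (((k : ℝ)⁻¹ * fiCutoff x y (x * s ^ 2 / (k : ℝ) ^ 2 + (c : ℝ) ^ 4) : ℝ) : ℂ)

/-- The linear form `Ξ_d(s) = ∑_{k ≤ K} ∑_{ℓ ≤ C₀²} ξ_s(k, ℓ) ρ(k, ℓ; d)` to which Lemma 3.3 is applied.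
[cite: FriedlanderIwaniecAnnals1998, §3, "the relevant triple sum"] -/
def fiXiForm (x y : ℝ) (K C₀ d : ℕ) (s : ℝ) : ℂ :=
  ∑ k ∈ Finset.Icc 1 K, ∑ ℓ ∈ Finset.Icc 1 (C₀ ^ 2), fiXi x y C₀ s k ℓ * fiWeyl k ℓ d

/-- The fibres of `c ↦ c²` on `[1, C₀]` have at most one element. [folklore] -/
theorem card_filter_sq_eq_le_one (C₀ ℓ : ℕ) :
    #((Finset.Icc 1 C₀).filter (fun c => c ^ 2 = ℓ)) ≤ 1 :=
  Finset.card_le_one.mpr fun a ha b hb => by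
    have h := (Finset.mem_filter.mp ha).2.trans (Finset.mem_filter.mp hb).2.symm
    exact Nat.pow_left_injective two_ne_zero h

/-- **`Ξ_d(s)` fibrewise**: `Ξ_d(s) = ∑_{k ≤ K} ∑_{1 ≤ c ≤ C₀} k⁻¹ f(xs²/k² + c⁴) ρ(k, c²; d)`.
[cite: FriedlanderIwaniecAnnals1998, §3, the triple sum before (3.13)] -/
theorem fiXiForm_eq (x y : ℝ) (K C₀ d : ℕ) (s : ℝ) :
    fiXiForm x y K C₀ d s = ∑ k ∈ Finset.Icc 1 K, ∑ c ∈ Finset.Icc 1 C₀,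
      (((k : ℝ)⁻¹ * fiCutoff x y (x * s ^ 2 / (k : ℝ) ^ 2 + (c : ℝ) ^ 4) : ℝ) : ℂ) *
        fiWeyl k (c ^ 2) d := by
  unfold fiXiForm fiXi
  refine Finset.sum_congr rfl fun k _ => ?_
  rw [← Finset.sum_fiberwise_of_maps_to (s := Finset.Icc 1 C₀) (t := Finset.Icc 1 (C₀ ^ 2))
    (g := fun c => c ^ 2) fun c hc => ?_]
  · refine Finset.sum_congr rfl fun ℓ _ => ?_
    rw [Finset.sum_mul]
    refine Finset.sum_congr rfl fun c hc => ?_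
    rw [(Finset.mem_filter.mp hc).2]
  · rw [Finset.mem_Icc] at hc ⊢
    exact ⟨Nat.one_le_pow _ _ hc.1, Nat.pow_le_pow_left hc.2 2⟩

/-! ### The change of variables, summed over `k` and `c` -/

/-- `s ↦ e(g(s))` is continuous for continuous `g`. [folklore] -/
theorem continuous_e_comp {g : ℝ → ℝ} (hg : Continuous g) : Continuous fun s => e (g s) :=
  continuous_subtype_val.comp (Real.continuous_fourierChar.comp hg)

/-- The cut-off factor `s ↦ k⁻¹ f(xs²/k² + h)` is continuous. [folklore] -/
theorem continuous_cutoff_factor (x y h : ℝ) (k : ℕ) :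
    Continuous fun s : ℝ => (((k : ℝ)⁻¹ * fiCutoff x y (x * s ^ 2 / (k : ℝ) ^ 2 + h) : ℝ) : ℂ) :=
  continuous_ofReal.comp (continuous_const.mul ((continuous_fiCutoff x y).comp (by fun_prop)))

/-- The cut-off factor vanishes for `|s| ≥ k` (`x > 0`, `y > 0`, `h ≥ 0`, `k ≥ 1`):
`xs²/k² ≥ x`. [folklore] -/
theorem cutoff_factor_eq_zero {x y h : ℝ} (hx : 0 < x) (hy : 0 < y) (hh : 0 ≤ h) {k : ℕ}
    (hk : 1 ≤ k) {s : ℝ} (hs : (k : ℝ) ≤ |s|) :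
    (k : ℝ)⁻¹ * fiCutoff x y (x * s ^ 2 / (k : ℝ) ^ 2 + h) = 0 := by
  rw [fiCutoff_eq_zero hy, mul_zero]
  have hk0 : (0 : ℝ) < k := by exact_mod_cast hk
  have h1 : (k : ℝ) ^ 2 ≤ s ^ 2 := by
    calc (k : ℝ) ^ 2 ≤ |s| ^ 2 := pow_le_pow_left₀ hk0.le hs 2
      _ = s ^ 2 := sq_abs s
  have h2 : x ≤ x * s ^ 2 / (k : ℝ) ^ 2 := by
    rw [le_div_iff₀ (by positivity)]
    exact mul_le_mul_of_nonneg_left h1 hx.le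
  linarith

/-- **The change of variables `t = s√x/k`, summed** ("`I(k,b;d) = √x k⁻¹ ∫ f(xt²k⁻² + b²) cos(2πt√x/d) dt`",
complex form): for `x > 0`, `d ≥ 1`,
`∑_{k ≤ K} ∑_{c ≤ C₀} ρ(k, c²; d) 𝓕F_c(k/d) = √x ∫ e(-s√x/d) Ξ_d(s) ds`.
[cite: FriedlanderIwaniecAnnals1998, §3, display before (3.13)] -/
theorem sum_sum_fiWeyl_mul_fourier_eq {x y : ℝ} (hx : 0 < x) (hy : 0 < y) (K C₀ d : ℕ) :
    ∑ k ∈ Finset.Icc 1 K, ∑ c ∈ Finset.Icc 1 C₀,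
        fiWeyl k (c ^ 2) d * 𝓕 (fiProfileC x y ((c : ℝ) ^ 4)) ((k : ℝ) / d) =
      (Real.sqrt x : ℂ) * ∫ s : ℝ, (𝐞 (-(s * Real.sqrt x / d)) : ℂ) • fiXiForm x y K C₀ d s := by
  -- each summand as an integral
  have hterm : ∀ k ∈ Finset.Icc 1 K, ∀ c ∈ Finset.Icc 1 C₀,
      fiWeyl k (c ^ 2) d * 𝓕 (fiProfileC x y ((c : ℝ) ^ 4)) ((k : ℝ) / d) =
        (Real.sqrt x : ℂ) * ∫ s : ℝ, (𝐞 (-(s * Real.sqrt x / d)) : ℂ) •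
          ((((k : ℝ)⁻¹ * fiCutoff x y (x * s ^ 2 / (k : ℝ) ^ 2 + (c : ℝ) ^ 4) : ℝ) : ℂ) *
            fiWeyl k (c ^ 2) d) := by
    intro k hk c _
    rw [Finset.mem_Icc] at hk
    have hk0 : (0 : ℝ) < k := by exact_mod_cast hk.1
    rw [fourier_fiProfileC_div hx hk0 (d : ℝ)]
    have hI : ∫ s : ℝ, (𝐞 (-(s * Real.sqrt x / d)) : ℂ) •
        ((((k : ℝ)⁻¹ * fiCutoff x y (x * s ^ 2 / (k : ℝ) ^ 2 + (c : ℝ) ^ 4) : ℝ) : ℂ) *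
          fiWeyl k (c ^ 2) d) =
        ((k : ℂ)⁻¹ * fiWeyl k (c ^ 2) d) * ∫ s : ℝ, 𝐞 (-(s * Real.sqrt x / d)) •
          ((fiCutoff x y (x * s ^ 2 / (k : ℝ) ^ 2 + (c : ℝ) ^ 4) : ℝ) : ℂ) := by
      rw [← integral_const_mul]
      refine integral_congr_ae (Filter.Eventually.of_forall fun s => ?_)
      simp only [Circle.smul_def, smul_eq_mul]
      push_cast
      ring
    rw [hI, Complex.ofReal_div, Complex.ofReal_natCast]
    ring
  rw [Finset.sum_congr rfl fun k hk => Finset.sum_congr rfl fun c hc => hterm k hk c hc]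
  simp_rw [← Finset.mul_sum]
  congr 1
  -- interchange the finite sums and the integral
  have hint : ∀ k ∈ Finset.Icc 1 K, ∀ c ∈ Finset.Icc 1 C₀, Integrable fun s : ℝ =>
      (𝐞 (-(s * Real.sqrt x / d)) : ℂ) •
        ((((k : ℝ)⁻¹ * fiCutoff x y (x * s ^ 2 / (k : ℝ) ^ 2 + (c : ℝ) ^ 4) : ℝ) : ℂ) *
          fiWeyl k (c ^ 2) d) := by
    intro k hk c _
    rw [Finset.mem_Icc] at hk
    refine Continuous.integrable_of_hasCompactSupport ?_ ?_
    · exact (continuous_e_comp (by fun_prop)).smul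
        ((continuous_cutoff_factor x y _ k).mul continuous_const)
    · refine HasCompactSupport.intro (isCompact_Icc : IsCompact (Icc (-(k : ℝ)) k)) fun s hs => ?_
      rw [Set.mem_Icc, not_and_or, not_le, not_le] at hs
      have hs' : (k : ℝ) ≤ |s| := by
        rcases hs with hs | hs
        · rw [abs_of_neg (by linarith [Nat.cast_nonneg (α := ℝ) k])]; linarith
        · exact hs.le.trans (le_abs_self s)
      rw [cutoff_factor_eq_zero hx hy (by positivity) hk.1 hs']
      simp
  symm
  calc ∫ s : ℝ, (𝐞 (-(s * Real.sqrt x / d)) : ℂ) • fiXiForm x y K C₀ d s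
      = ∫ s : ℝ, ∑ k ∈ Finset.Icc 1 K, ∑ c ∈ Finset.Icc 1 C₀, (𝐞 (-(s * Real.sqrt x / d)) : ℂ) •
          ((((k : ℝ)⁻¹ * fiCutoff x y (x * s ^ 2 / (k : ℝ) ^ 2 + (c : ℝ) ^ 4) : ℝ) : ℂ) *
            fiWeyl k (c ^ 2) d) := by
        refine integral_congr_ae (Filter.Eventually.of_forall fun s => ?_)
        simp only [fiXiForm_eq, Finset.smul_sum]
    _ = ∑ k ∈ Finset.Icc 1 K, ∫ s : ℝ, ∑ c ∈ Finset.Icc 1 C₀, (𝐞 (-(s * Real.sqrt x / d)) : ℂ) •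
          ((((k : ℝ)⁻¹ * fiCutoff x y (x * s ^ 2 / (k : ℝ) ^ 2 + (c : ℝ) ^ 4) : ℝ) : ℂ) *
            fiWeyl k (c ^ 2) d) :=
        integral_finsetSum _ fun k hk => integrable_finsetSum _ fun c hc => hint k hk c hc
    _ = _ := Finset.sum_congr rfl fun k hk => integral_finsetSum _ fun c hc => hint k hk c hc

/-! ### The size of the coefficients and the support of `Ξ_d` -/

/-- `|ξ_s(k, ℓ)|² ≤ ∑_{c ≤ C₀, c² = ℓ} k⁻² · [|s| < k]` (at most one term, `0 ≤ f ≤ 1`, and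
`f(xs²/k² + c⁴) = 0` unless `|s| < k`). [folklore] -/
theorem norm_fiXi_sq_le {x y : ℝ} (hx : 0 < x) (hy : 0 < y) (C₀ : ℕ) (s : ℝ) {k : ℕ} (hk : 1 ≤ k)
    (ℓ : ℕ) :
    ‖fiXi x y C₀ s k ℓ‖ ^ 2 ≤ ∑ _c ∈ (Finset.Icc 1 C₀).filter (fun c => c ^ 2 = ℓ),
      (if |s| < k then ((k : ℝ) ^ 2)⁻¹ else 0) := by
  have hk0 : (0 : ℝ) < k := by exact_mod_cast hk
  set S := (Finset.Icc 1 C₀).filter (fun c => c ^ 2 = ℓ) with hS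
  set g : ℕ → ℂ := fun c =>
    ((((k : ℝ)⁻¹ * fiCutoff x y (x * s ^ 2 / (k : ℝ) ^ 2 + (c : ℝ) ^ 4)) : ℝ) : ℂ) with hg
  have hcard := card_filter_sq_eq_le_one C₀ ℓ
  have hfiXi : fiXi x y C₀ s k ℓ = ∑ c ∈ S, g c := rfl
  -- termwise bound
  have hterm : ∀ c : ℕ, ‖g c‖ ≤ (if |s| < k then (k : ℝ)⁻¹ else 0) := by
    intro c
    rw [hg]
    simp only
    rw [Complex.norm_real, Real.norm_eq_abs]
    split_ifs with h
    · rw [abs_mul, abs_of_pos (inv_pos.mpr hk0)]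
      refine mul_le_of_le_one_right (inv_nonneg.mpr hk0.le) ?_
      rw [abs_of_nonneg (fiCutoff_mem_Icc _ _ _).1]
      exact (fiCutoff_mem_Icc _ _ _).2
    · rw [not_lt] at h
      rw [cutoff_factor_eq_zero hx hy (by positivity) hk h, abs_zero]
  calc ‖fiXi x y C₀ s k ℓ‖ ^ 2 ≤ (∑ c ∈ S, ‖g c‖) ^ 2 := by
        rw [hfiXi]
        exact pow_le_pow_left₀ (norm_nonneg _) (norm_sum_le _ _) 2
    _ ≤ #S * ∑ c ∈ S, ‖g c‖ ^ 2 := sq_sum_le_card_mul_sum_sq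
    _ ≤ 1 * ∑ c ∈ S, ‖g c‖ ^ 2 := by
        have h1 : (#S : ℝ) ≤ 1 := by exact_mod_cast hcard
        exact mul_le_mul_of_nonneg_right h1 (Finset.sum_nonneg fun _ _ => by positivity)
    _ = ∑ c ∈ S, ‖g c‖ ^ 2 := one_mul _
    _ ≤ ∑ c ∈ S, (if |s| < k then ((k : ℝ) ^ 2)⁻¹ else 0) := by
        refine Finset.sum_le_sum fun c _ => ?_
        have h := hterm c
        split_ifs at h ⊢ with hs
        · calc _ ≤ ((k : ℝ)⁻¹) ^ 2 := pow_le_pow_left₀ (norm_nonneg _) h 2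
            _ = ((k : ℝ) ^ 2)⁻¹ := by rw [inv_pow]
        · rw [le_antisymm h (norm_nonneg _)]
          simp

/-- `∑_{|s| < k ≤ K} k⁻² ≤ 2 / max(1, |s|)`. [folklore] -/
theorem sum_inv_sq_filter_le (s : ℝ) (K : ℕ) :
    ∑ k ∈ Finset.Icc 1 K, (if |s| < k then ((k : ℝ) ^ 2)⁻¹ else 0) ≤ 2 / max 1 |s| := by
  rw [← Finset.sum_filter]
  rcases lt_or_ge |s| 1 with hs | hs
  · rw [max_eq_left hs.le, div_one]
    calc ∑ k ∈ (Finset.Icc 1 K).filter (fun k : ℕ => |s| < k), ((k : ℝ) ^ 2)⁻¹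
        ≤ ∑ k ∈ Finset.Icc 1 K, ((k : ℝ) ^ 2)⁻¹ :=
          Finset.sum_le_sum_of_subset_of_nonneg (Finset.filter_subset _ _) fun _ _ _ => by positivity
      _ ≤ 2 := sum_Icc_inv_sq_le_two K
  · rw [max_eq_right hs]
    set m : ℕ := ⌊|s|⌋₊ with hm
    have hm1 : 1 ≤ m := Nat.le_floor (by simpa using hs)
    have hms : (m : ℝ) ≤ |s| := Nat.floor_le (abs_nonneg s)
    have hsm : |s| < m + 1 := Nat.lt_floor_add_one _
    -- the filter lies in `Ioc m K`
    have hsub : (Finset.Icc 1 K).filter (fun k : ℕ => |s| < k) ⊆ Finset.Ioc m K := by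
      intro k hk
      rw [Finset.mem_filter, Finset.mem_Icc] at hk
      rw [Finset.mem_Ioc]
      refine ⟨?_, hk.1.2⟩
      have : (m : ℝ) < k := hms.trans_lt hk.2
      exact_mod_cast this
    rcases le_or_gt K m with hKm | hKm
    · rw [Finset.eq_empty_of_forall_notMem (s := (Finset.Icc 1 K).filter (fun k : ℕ => |s| < k))
        fun k hk => by have := hsub hk; rw [Finset.mem_Ioc] at this; omega, Finset.sum_empty]
      positivity
    calc ∑ k ∈ (Finset.Icc 1 K).filter (fun k : ℕ => |s| < k), ((k : ℝ) ^ 2)⁻¹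
        ≤ ∑ k ∈ Finset.Ioc m K, ((k : ℝ) ^ 2)⁻¹ :=
          Finset.sum_le_sum_of_subset_of_nonneg hsub fun _ _ _ => by positivity
      _ ≤ (m : ℝ)⁻¹ - (K : ℝ)⁻¹ := sum_Ioc_inv_sq_le_sub (by omega) hKm.le
      _ ≤ (m : ℝ)⁻¹ := by linarith [inv_nonneg.mpr (Nat.cast_nonneg K : (0 : ℝ) ≤ K)]
      _ ≤ 2 / |s| := by
          have hm0 : (0 : ℝ) < m := by exact_mod_cast hm1
          have hm1r : (1 : ℝ) ≤ m := by exact_mod_cast hm1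
          rw [inv_eq_one_div, div_le_div_iff₀ hm0 (by linarith)]
          linarith

/-- **`‖ξ_s‖² ≤ 2 C₀ / max(1, |s|)`.** [cite: FriedlanderIwaniecAnnals1998, §3, "then integrating over 0 < t < K"] -/
theorem sum_norm_fiXi_sq_le {x y : ℝ} (hx : 0 < x) (hy : 0 < y) (K C₀ : ℕ) (s : ℝ) :
    ∑ k ∈ Finset.Icc 1 K, ∑ ℓ ∈ Finset.Icc 1 (C₀ ^ 2), ‖fiXi x y C₀ s k ℓ‖ ^ 2 ≤
      2 * C₀ / max 1 |s| := by
  calc ∑ k ∈ Finset.Icc 1 K, ∑ ℓ ∈ Finset.Icc 1 (C₀ ^ 2), ‖fiXi x y C₀ s k ℓ‖ ^ 2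
      ≤ ∑ k ∈ Finset.Icc 1 K, ∑ ℓ ∈ Finset.Icc 1 (C₀ ^ 2),
          ∑ c ∈ (Finset.Icc 1 C₀).filter (fun c => c ^ 2 = ℓ),
            (if |s| < k then ((k : ℝ) ^ 2)⁻¹ else 0) := by
        refine Finset.sum_le_sum fun k hk => Finset.sum_le_sum fun ℓ _ => ?_
        exact norm_fiXi_sq_le hx hy C₀ s (Finset.mem_Icc.mp hk).1 ℓ
    _ = ∑ k ∈ Finset.Icc 1 K, ∑ c ∈ Finset.Icc 1 C₀, (if |s| < k then ((k : ℝ) ^ 2)⁻¹ else 0) := by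
        refine Finset.sum_congr rfl fun k _ => ?_
        exact Finset.sum_fiberwise_of_maps_to (s := Finset.Icc 1 C₀) (t := Finset.Icc 1 (C₀ ^ 2))
          (g := fun c => c ^ 2) (fun c hc => by
            rw [Finset.mem_Icc] at hc ⊢
            exact ⟨Nat.one_le_pow _ _ hc.1, Nat.pow_le_pow_left hc.2 2⟩) _
    _ = C₀ * ∑ k ∈ Finset.Icc 1 K, (if |s| < k then ((k : ℝ) ^ 2)⁻¹ else 0) := by
        rw [Finset.mul_sum]
        refine Finset.sum_congr rfl fun k _ => ?_
        rw [Finset.sum_const, Nat.card_Icc, nsmul_eq_mul]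
        simp
    _ ≤ C₀ * (2 / max 1 |s|) :=
        mul_le_mul_of_nonneg_left (sum_inv_sq_filter_le s K) (Nat.cast_nonneg _)
    _ = 2 * C₀ / max 1 |s| := by ring

/-- `Ξ_d(s) = 0` for `|s| ≥ K` (every cut-off factor vanishes). [folklore] -/
theorem fiXiForm_eq_zero {x y : ℝ} (hx : 0 < x) (hy : 0 < y) {K : ℕ} (C₀ d : ℕ) {s : ℝ}
    (hs : (K : ℝ) ≤ |s|) : fiXiForm x y K C₀ d s = 0 := by
  rw [fiXiForm_eq]
  refine Finset.sum_eq_zero fun k hk => Finset.sum_eq_zero fun c _ => ?_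
  rw [Finset.mem_Icc] at hk
  have hks : (k : ℝ) ≤ |s| := le_trans (by exact_mod_cast hk.2) hs
  rw [cutoff_factor_eq_zero hx hy (by positivity) hk.1 hks]
  simp

/-- `Ξ_d` is continuous. [folklore] -/
theorem continuous_fiXiForm (x y : ℝ) (K C₀ d : ℕ) : Continuous (fiXiForm x y K C₀ d) := by
  have : fiXiForm x y K C₀ d = fun s => ∑ k ∈ Finset.Icc 1 K, ∑ c ∈ Finset.Icc 1 C₀,
      (((k : ℝ)⁻¹ * fiCutoff x y (x * s ^ 2 / (k : ℝ) ^ 2 + (c : ℝ) ^ 4) : ℝ) : ℂ) *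
        fiWeyl k (c ^ 2) d := funext fun s => fiXiForm_eq x y K C₀ d s
  rw [this]
  exact continuous_finsetSum _ fun k _ => continuous_finsetSum _ fun c _ =>
    (continuous_cutoff_factor x y _ k).mul continuous_const

/-! ### The weight `max(1, |s|)^{-1/2}` and its integral over `[-K, K]` -/

/-- `∫_{-K}^{K} max(1,|s|)^{-1/2} ds ≤ 4√K` for `K ≥ 1`. [folklore] -/
theorem integral_weight_le {K : ℝ} (hK : 1 ≤ K) :
    ∫ s in Icc (-K) K, (max 1 |s|) ^ (-(1 / 2 : ℝ)) ≤ 4 * Real.sqrt K := by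
  have hK0 : 0 ≤ K := zero_le_one.trans hK
  have hcont : Continuous fun s : ℝ => (max 1 |s|) ^ (-(1 / 2 : ℝ)) :=
    (continuous_const.max continuous_abs).rpow_const fun s =>
      Or.inl (ne_of_gt (lt_of_lt_of_le zero_lt_one (le_max_left 1 |s|)))
  -- pointwise: `max(1,|s|)^{-1/2} ≤ g(s)` with `g(s) = 1` on `|s| ≤ 1`, `|s|^{-1/2}` beyond
  rw [integral_Icc_eq_integral_Ioc, ← intervalIntegral.integral_of_le (by linarith)]
  -- split at `-1` and `1`
  have hii : ∀ a b : ℝ, IntervalIntegrable (fun s : ℝ => (max 1 |s|) ^ (-(1 / 2 : ℝ))) volume a b :=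
    fun a b => hcont.intervalIntegrable _ _
  rw [← intervalIntegral.integral_add_adjacent_intervals (hii (-K) (-1)) (hii (-1) K),
    ← intervalIntegral.integral_add_adjacent_intervals (hii (-1) 1) (hii 1 K)]
  -- the middle piece
  have hmid : ∫ s in (-1 : ℝ)..1, (max 1 |s|) ^ (-(1 / 2 : ℝ)) = 2 := by
    rw [intervalIntegral.integral_congr (g := fun _ => (1 : ℝ)) fun s hs => ?_]
    · simp; norm_num
    · rw [Set.uIcc_of_le (by norm_num)] at hs
      simp only
      rw [max_eq_left (abs_le.mpr ⟨hs.1, hs.2⟩), Real.one_rpow]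
  -- the right piece
  have hright : ∫ s in (1 : ℝ)..K, (max 1 |s|) ^ (-(1 / 2 : ℝ)) = 2 * Real.sqrt K - 2 := by
    rw [intervalIntegral.integral_congr (g := fun s => s ^ (-(1 / 2 : ℝ))) fun s hs => ?_]
    · rw [integral_rpow (Or.inl (by norm_num))]
      rw [show (-(1 / 2 : ℝ) + 1) = 1 / 2 by norm_num, Real.one_rpow, ← Real.sqrt_eq_rpow]
      ring
    · rw [Set.uIcc_of_le hK] at hs
      simp only
      rw [max_eq_right (by rw [abs_of_pos (by linarith [hs.1])]; exact hs.1),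
        abs_of_pos (by linarith [hs.1])]
  -- the left piece equals the right one
  have hleft : ∫ s in (-K : ℝ)..(-1), (max 1 |s|) ^ (-(1 / 2 : ℝ)) = 2 * Real.sqrt K - 2 := by
    rw [← hright, ← intervalIntegral.integral_comp_neg]
    simp only [abs_neg]
  rw [hleft, hmid, hright]
  have : 0 ≤ Real.sqrt K := Real.sqrt_nonneg K
  linarith

/-! ### Lemma 3.3 applied and integrated -/

/-- **The oscillatory terms** ("Applying Lemma 3.3 to the relevant triple sum and then integrating
over `0 < t < K`"): for `ε > 0` and `c = c(ε)` as in `fi_lemma33`, for `x > 0`, `0 < y`,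
`K ≥ 1` and all `D, C₀`,
`∑_{d ≤ D} |∑_{k ≤ K} ∑_{c ≤ C₀} ρ(k, c²; d) 𝓕F_c(k/d)| ≤ √x · c (DKL)^ε (D + √(DKL)) √(2C₀) · 4√K`,
`L = C₀²`. [cite: FriedlanderIwaniecAnnals1998, §3 (3.13)] -/
theorem sum_norm_oscillatory_le {ε c : ℝ} (hc0 : 0 < c)
    (hc : ∀ (D K L : ℕ) (ξ : ℕ → ℕ → ℂ),
      ∑ d ∈ Finset.Icc 1 D, ‖∑ k ∈ Finset.Icc 1 K, ∑ ℓ ∈ Finset.Icc 1 L, ξ k ℓ * fiWeyl k ℓ d‖ ≤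
        c * ((D : ℝ) * K * L) ^ ε * ((D : ℝ) + Real.sqrt ((D : ℝ) * K * L)) *
          Real.sqrt (∑ k ∈ Finset.Icc 1 K, ∑ ℓ ∈ Finset.Icc 1 L, ‖ξ k ℓ‖ ^ 2))
    {x y : ℝ} (hx : 0 < x) (hy : 0 < y) {K : ℕ} (hK : 1 ≤ K) (C₀ D : ℕ) :
    ∑ d ∈ Finset.Icc 1 D, ‖∑ k ∈ Finset.Icc 1 K, ∑ c ∈ Finset.Icc 1 C₀,
        fiWeyl k (c ^ 2) d * 𝓕 (fiProfileC x y ((c : ℝ) ^ 4)) ((k : ℝ) / d)‖ ≤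
      Real.sqrt x * (c * ((D : ℝ) * K * (C₀ ^ 2 : ℕ)) ^ ε *
        ((D : ℝ) + Real.sqrt ((D : ℝ) * K * (C₀ ^ 2 : ℕ))) * Real.sqrt (2 * C₀) *
        (4 * Real.sqrt K)) := by
  have hKr : (1 : ℝ) ≤ K := by exact_mod_cast hK
  set L : ℕ := C₀ ^ 2 with hL
  set A : ℝ := c * ((D : ℝ) * K * (L : ℝ)) ^ ε * ((D : ℝ) + Real.sqrt ((D : ℝ) * K * L)) with hA
  have hA0 : 0 ≤ A := by positivity
  set w : ℝ → ℝ := fun s => (max 1 |s|) ^ (-(1 / 2 : ℝ)) with hw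
  have hw0 : ∀ s, 0 < w s := fun s => Real.rpow_pos_of_pos (lt_of_lt_of_le zero_lt_one (le_max_left _ _)) _
  have hwcont : Continuous w := (continuous_const.max continuous_abs).rpow_const fun s =>
    Or.inl (ne_of_gt (lt_of_lt_of_le zero_lt_one (le_max_left 1 |s|)))
  -- Step 1: pointwise in `s`, Lemma 3.3 and the size of `ξ_s`
  have hpt : ∀ s : ℝ, ∑ d ∈ Finset.Icc 1 D, ‖fiXiForm x y K C₀ d s‖ ≤ A * Real.sqrt (2 * C₀) * w s := by
    intro s
    refine (hc D K L (fiXi x y C₀ s)).trans ?_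
    rw [hA, mul_assoc (c * _ * _)]
    refine mul_le_mul_of_nonneg_left ?_ (by positivity)
    calc Real.sqrt (∑ k ∈ Finset.Icc 1 K, ∑ ℓ ∈ Finset.Icc 1 L, ‖fiXi x y C₀ s k ℓ‖ ^ 2)
        ≤ Real.sqrt (2 * C₀ / max 1 |s|) := Real.sqrt_le_sqrt (sum_norm_fiXi_sq_le hx hy K C₀ s)
      _ = Real.sqrt (2 * C₀) * w s := by
          rw [hw]
          simp only
          rw [Real.sqrt_div (by positivity), Real.rpow_neg (le_trans zero_le_one (le_max_left _ _)),
            ← Real.sqrt_eq_rpow, div_eq_mul_inv]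
  -- Step 2: each oscillatory sum is `√x ∫ e(·) Ξ_d`, of norm `≤ √x ∫_{[-K,K]} ‖Ξ_d‖`
  have hosc : ∀ d ∈ Finset.Icc 1 D, ‖∑ k ∈ Finset.Icc 1 K, ∑ c ∈ Finset.Icc 1 C₀,
      fiWeyl k (c ^ 2) d * 𝓕 (fiProfileC x y ((c : ℝ) ^ 4)) ((k : ℝ) / d)‖ ≤
        Real.sqrt x * ∫ s in Icc (-(K : ℝ)) K, ‖fiXiForm x y K C₀ d s‖ := by
    intro d _
    rw [sum_sum_fiWeyl_mul_fourier_eq hx hy K C₀ d, norm_mul, Complex.norm_real,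
      Real.norm_of_nonneg (Real.sqrt_nonneg x)]
    refine mul_le_mul_of_nonneg_left ?_ (Real.sqrt_nonneg x)
    refine (norm_integral_le_integral_norm _).trans (le_of_eq ?_)
    rw [← setIntegral_eq_integral_of_forall_compl_eq_zero (s := Icc (-(K : ℝ)) K) fun s hs => ?_]
    · refine setIntegral_congr_fun measurableSet_Icc fun s _ => ?_
      rw [norm_smul, Circle.norm_coe, one_mul]
    · rw [Set.mem_Icc, not_and_or, not_le, not_le] at hs
      have hs' : (K : ℝ) ≤ |s| := by
        rcases hs with hs | hs
        · rw [abs_of_neg (by linarith)]; linarith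
        · exact hs.le.trans (le_abs_self s)
      rw [fiXiForm_eq_zero hx hy C₀ d hs', smul_zero, norm_zero]
  -- Step 3: sum over `d`, move the sum inside the integral, and integrate the weight
  have hint : ∀ d : ℕ, IntegrableOn (fun s => ‖fiXiForm x y K C₀ d s‖) (Icc (-(K : ℝ)) K) :=
    fun d => ((continuous_fiXiForm x y K C₀ d).norm).integrableOn_Icc
  calc ∑ d ∈ Finset.Icc 1 D, ‖∑ k ∈ Finset.Icc 1 K, ∑ c ∈ Finset.Icc 1 C₀,
        fiWeyl k (c ^ 2) d * 𝓕 (fiProfileC x y ((c : ℝ) ^ 4)) ((k : ℝ) / d)‖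
      ≤ ∑ d ∈ Finset.Icc 1 D, Real.sqrt x * ∫ s in Icc (-(K : ℝ)) K, ‖fiXiForm x y K C₀ d s‖ :=
        Finset.sum_le_sum hosc
    _ = Real.sqrt x * ∫ s in Icc (-(K : ℝ)) K, ∑ d ∈ Finset.Icc 1 D, ‖fiXiForm x y K C₀ d s‖ := by
        rw [← Finset.mul_sum, integral_finsetSum _ fun d _ => hint d]
    _ ≤ Real.sqrt x * ∫ s in Icc (-(K : ℝ)) K, A * Real.sqrt (2 * C₀) * w s := by
        refine mul_le_mul_of_nonneg_left ?_ (Real.sqrt_nonneg x)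
        refine setIntegral_mono_on (integrable_finsetSum _ fun d _ => hint d)
          ((hwcont.const_mul _).integrableOn_Icc) measurableSet_Icc fun s _ => hpt s
    _ = Real.sqrt x * (A * Real.sqrt (2 * C₀) * ∫ s in Icc (-(K : ℝ)) K, w s) := by
        rw [integral_const_mul]
    _ ≤ Real.sqrt x * (A * Real.sqrt (2 * C₀) * (4 * Real.sqrt K)) := by
        gcongr
        exact integral_weight_le hKr

end Literature.NumberTheory.Sieve.FriedlanderIwaniecPrimes
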